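import Literature.Analysis.UnboundedOperators.HeatKernelBoundedData
import Literature.Analysis.UnboundedOperators.HeatExtensionDecay
import HarnessLib

/-!
# Iterated derivatives of the caloric extension: derivatives fall on `C^k` data, and the
# all-order smoothing bounds `‖∇ᵏ e^{tΔ} f‖_∞ ≤ A_k t^{-k/2} ‖f‖_∞`

Analysis/UnboundedOperators support file (all results proved; no named facts). It serves the
regularity theory of bounded ("drift-mild") solutions of the Navier–Stokes equations of
Koch–Nadirashvili–Seregin–Šverák 2009, §4 (`FluidPDE/KNSSRegularityPlanar`, the bootstrap behind
Proposition 4.1 and (4.10): "the local-in-time smoothing properties of Navier–Stokes for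
`u₀ ∈ L^∞` are the same as those of the heat equation", Remark 4.2), which needs the derivative
estimates of the heat semigroup on `L^∞` data **of every order**, whereas the tree so far has
order one (`norm_fderiv_heatExtension_le_of_bounded`, `HeatKernelBoundedData`).

Let `E` be a finite-dimensional real inner product space (`d = dim E`), `F` a real Banach space,
`e^{tΔ} g = heatExtension g t`, `0 < t`.

* `fderiv_heatExtension_of_bounded`: `D(e^{tΔ} g) = e^{tΔ}(Dg)` as `E →L[ℝ] F`-valued functions,
  for `g ∈ C¹` with `g`, `Dg` bounded (the operator-valued form of the tree's directional lemma
  `fderiv_heatExtension_apply_of_bounded`; the right-hand side is the caloric extension of the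
  `E →L[ℝ] F`-valued function `Dg`).
* `iteratedFDeriv_heatExtension_of_bounded`: `Dᵏ(e^{tΔ} g) = e^{tΔ}(Dᵏg)` for `g ∈ Cⁿ` whose
  derivatives of orders `≤ n` are bounded, `k ≤ n` (induction on `k` through the currying
  isometry `iteratedFDeriv_succ_eq_comp_left`); hence `‖Dᵏ(e^{tΔ} g)(x)‖ ≤ sup ‖Dᵏg‖`
  (`norm_iteratedFDeriv_heatExtension_le_of_bounded`, maximum principle) and the one-derivative
  gain on top, `‖Dⁿ⁺¹(e^{tΔ} g)(x)‖ ≤ 2^{d/2} t^{-1/2} sup ‖Dⁿg‖`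
  (`norm_iteratedFDeriv_succ_heatExtension_le_of_bounded`).
* `exists_norm_iteratedFDeriv_heatExtension_le`: for every `k` there is `A_k ≥ 0` (depending on
  `k` and `d` only) with `‖Dᵏ(e^{tΔ} f)(x)‖ ≤ A_k t^{-k/2} C` for all `t > 0`, all measurable `f`
  with `‖f‖ ≤ C` and all `x` — Giga–Giga–Saal 2010, §1.1.3 (the derivative estimates
  `‖∂ˣ_α e^{tΔ} f‖_∞ ≤ C t^{-|α|/2} ‖f‖_∞`), here by induction on `k` via the semigroup law
  `e^{tΔ} = e^{(t/2)Δ} e^{(t/2)Δ}` and the order-one bound, so `A_{k+1} = 2^{d/2} 2^{(k+1)/2} A_k`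
  (the sharp constants of the source, from `‖∂^α G_t‖₁`, are not needed downstream).

## References

* M.-H. Giga, Y. Giga, J. Saal, *Nonlinear Partial Differential Equations*, Birkhäuser 2010,
  §1.1.3 (derivative estimates for the heat semigroup). [GigaGigaSaal2010]
* G. Koch, N. Nadirashvili, G. Seregin, V. Šverák, Acta Math. 203 (2009) = arXiv:0709.3599,
  Prop. 4.1 and Remark 4.2 (p. 8). [KochNadirashviliSereginSverak2009]
-/

noncomputable section

open MeasureTheory Set Function Filter
open scoped ENNReal NNReal ContDiff

namespace Literature.Analysis.UnboundedOperators

variable {E : Type*} [NormedAddCommGroup E] [InnerProductSpace ℝ E] [FiniteDimensional ℝ E]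
  [MeasurableSpace E] [BorelSpace E]
variable {F : Type*} [NormedAddCommGroup F] [NormedSpace ℝ F] [CompleteSpace F]

/-! ### Derivatives fall on `C^k` data with bounded derivatives -/

/-- **The full derivative falls on bounded `C¹` data**: if `g ∈ C¹(E; F)` with `‖g‖ ≤ C₀` and
`‖Dg‖ ≤ C₁` everywhere, then `D(e^{tΔ} g)(x) = e^{tΔ}(Dg)(x)` in `E →L[ℝ] F` for `0 < t`, the
right-hand side being the caloric extension of the operator-valued function `Dg`
(Giga–Giga–Saal 2010, §1.1.3; Lemarié-Rieusset 2016, §6.2: `W_t ∗ ∂u₀ = ∂(W_t ∗ u₀)`). [folklore] -/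
theorem fderiv_heatExtension_of_bounded {g : E → F} (hg : ContDiff ℝ 1 g) {C₀ C₁ : ℝ}
    (h0 : ∀ z, ‖g z‖ ≤ C₀) (h1 : ∀ z, ‖fderiv ℝ g z‖ ≤ C₁) {t : ℝ} (ht : 0 < t) (x : E) :
    fderiv ℝ (heatExtension g t) x = heatExtension (fderiv ℝ g) t x := by
  ext v
  have h1v : ∀ z, ‖fderiv ℝ g z v‖ ≤ C₁ * ‖v‖ := fun z =>
    (ContinuousLinearMap.le_opNorm _ _).trans (mul_le_mul_of_nonneg_right (h1 z) (norm_nonneg _))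
  rw [fderiv_heatExtension_apply_of_bounded hg h0 h1v ht x]
  have hc : Continuous (fderiv ℝ g) := hg.continuous_fderiv one_ne_zero
  have := heatExtension_clm_comp_of_bound (ContinuousLinearMap.apply ℝ F v) hc h1 ht x
  simpa only [ContinuousLinearMap.apply_apply] using this

/-- **Iterated derivatives fall on `Cⁿ` data with bounded derivatives**: if `g ∈ Cⁿ(E; F)` and
`‖Dʲg‖ ≤ C j` everywhere for all `j ≤ n`, then for `k ≤ n` and `0 < t`,
`Dᵏ(e^{tΔ} g) = e^{tΔ}(Dᵏ g)` (the caloric extension of the multilinear-map-valued `Dᵏg`).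
Induction on `k`: `Dᵏ⁺¹ = curry⁻¹ ∘ D(Dᵏ)` (`iteratedFDeriv_succ_eq_comp_left`), the previous
lemma for the bounded `C¹` function `Dᵏg`, and the commutation of `e^{tΔ}` with the currying
isometry. [folklore] -/
theorem iteratedFDeriv_heatExtension_of_bounded {g : E → F} {n : ℕ} (hg : ContDiff ℝ n g)
    {C : ℕ → ℝ} (hC : ∀ j ≤ n, ∀ z, ‖iteratedFDeriv ℝ j g z‖ ≤ C j) {t : ℝ} (ht : 0 < t) :
    ∀ k ≤ n, iteratedFDeriv ℝ k (heatExtension g t) = heatExtension (iteratedFDeriv ℝ k g) t := by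
  intro k
  induction k with
  | zero =>
    intro _
    funext x
    rw [iteratedFDeriv_zero_eq_comp, iteratedFDeriv_zero_eq_comp, Function.comp_apply]
    have h0 : ∀ z, ‖g z‖ ≤ C 0 := fun z => by
      have := hC 0 (Nat.zero_le _) z
      rwa [norm_iteratedFDeriv_zero] at this
    exact (heatExtension_clm_comp_of_bound
      ((continuousMultilinearCurryFin0 ℝ E F).symm : F →L[ℝ] E [×0]→L[ℝ] F) hg.continuous h0
      ht x).symm
  | succ k ih =>
    intro hk
    have hk' : k ≤ n := (Nat.le_succ k).trans hk
    have hfun := ih hk'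
    -- `G = Dᵏ g` is `C¹`, bounded, with bounded derivative
    set G : E → E [×k]→L[ℝ] F := iteratedFDeriv ℝ k g with hG
    have hG1 : ContDiff ℝ 1 G := by
      have hk1 : 1 + k ≤ n := by omega
      exact hg.iteratedFDeriv_right (i := k) (m := 1) (by exact_mod_cast hk1)
    have hG0 : ∀ z, ‖G z‖ ≤ C k := hC k hk'
    have hGd : ∀ z, ‖fderiv ℝ G z‖ ≤ C (k + 1) := fun z => by
      rw [hG, norm_fderiv_iteratedFDeriv]
      exact hC (k + 1) hk z
    funext x
    rw [iteratedFDeriv_succ_eq_comp_left, Function.comp_apply, hfun,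
      show (heatExtension (iteratedFDeriv ℝ k g) t) = heatExtension G t from rfl,
      fderiv_heatExtension_of_bounded hG1 hG0 hGd ht x]
    have hc : Continuous (fderiv ℝ G) := hG1.continuous_fderiv one_ne_zero
    let L : (E →L[ℝ] E [×k]→L[ℝ] F) →L[ℝ] E [×(k + 1)]→L[ℝ] F :=
      ((continuousMultilinearCurryLeftEquiv ℝ (fun _ : Fin (k + 1) => E) F).symm.toContinuousLinearEquiv :
        (E →L[ℝ] E [×k]→L[ℝ] F) →L[ℝ] E [×(k + 1)]→L[ℝ] F)
    have key := heatExtension_clm_comp_of_bound L (g := fderiv ℝ G) hc hGd ht x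
    exact key.symm

/-- **Maximum principle for derivatives**: under the hypotheses of
`iteratedFDeriv_heatExtension_of_bounded`, `‖Dᵏ(e^{tΔ} g)(x)‖ ≤ C k` for `k ≤ n` (the kernel has
mass one). [folklore] -/
theorem norm_iteratedFDeriv_heatExtension_le_of_bounded {g : E → F} {n : ℕ} (hg : ContDiff ℝ n g)
    {C : ℕ → ℝ} (hC : ∀ j ≤ n, ∀ z, ‖iteratedFDeriv ℝ j g z‖ ≤ C j) {t : ℝ} (ht : 0 < t)
    {k : ℕ} (hk : k ≤ n) (x : E) :
    ‖iteratedFDeriv ℝ k (heatExtension g t) x‖ ≤ C k := by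
  rw [iteratedFDeriv_heatExtension_of_bounded hg hC ht k hk]
  exact norm_heatExtension_le_of_bound (hC k hk) ht x

/-- **One derivative gained on top of `Cⁿ` data**: under the hypotheses of
`iteratedFDeriv_heatExtension_of_bounded`, `‖Dⁿ⁺¹(e^{tΔ} g)(x)‖ ≤ 2^{d/2} t^{-1/2} C n`
(`Dⁿ⁺¹(e^{tΔ}g) ≅ D(e^{tΔ} Dⁿg)` and the order-one sup bound
`norm_fderiv_heatExtension_le_of_bounded`; Giga–Giga–Saal 2010, §1.1.3). [cite: GigaGigaSaal2010, §1.1.3] -/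
theorem norm_iteratedFDeriv_succ_heatExtension_le_of_bounded {g : E → F} {n : ℕ}
    (hg : ContDiff ℝ n g) {C : ℕ → ℝ} (hC : ∀ j ≤ n, ∀ z, ‖iteratedFDeriv ℝ j g z‖ ≤ C j)
    {t : ℝ} (ht : 0 < t) (x : E) :
    ‖iteratedFDeriv ℝ (n + 1) (heatExtension g t) x‖ ≤
      (2 : ℝ) ^ ((Module.finrank ℝ E : ℝ) / 2) * t ^ (-(1 / 2 : ℝ)) * C n := by
  rw [← norm_fderiv_iteratedFDeriv, iteratedFDeriv_heatExtension_of_bounded hg hC ht n le_rfl]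
  have hc : Continuous (iteratedFDeriv ℝ n g) := hg.continuous_iteratedFDeriv le_rfl
  exact norm_fderiv_heatExtension_le_of_bounded hc.aestronglyMeasurable (hC n le_rfl) ht x

/-! ### All-order smoothing of bounded measurable data -/

/-- **All-order derivative estimates for the heat semigroup on `L^∞`** (Giga–Giga–Saal 2010,
§1.1.3: `‖∂ˣ_α e^{tΔ} f‖_p ≤ C t^{-|α|/2} ‖f‖_p`, here `p = ∞`): for every `k` there is
`A ≥ 0`, depending only on `k` and `d = dim E`, such that `‖Dᵏ(e^{tΔ} f)(x)‖ ≤ A t^{-k/2} C`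
whenever `0 < t`, `f` is a.e. strongly measurable with `‖f‖ ≤ C` everywhere. Proof by induction
on `k`: `e^{tΔ} f = e^{(t/2)Δ}(e^{(t/2)Δ} f)` (semigroup law), the inner factor has derivatives
of orders `≤ k` bounded by `A_j (t/2)^{-j/2} C` (induction hypothesis), and the outer heat flow
gains one derivative at the price `2^{d/2} (t/2)^{-1/2}`
(`norm_iteratedFDeriv_succ_heatExtension_le_of_bounded`). [cite: GigaGigaSaal2010, §1.1.3] -/
theorem exists_norm_iteratedFDeriv_heatExtension_le (k : ℕ) :
    ∃ A : ℝ, 0 ≤ A ∧ ∀ ⦃t : ℝ⦄, 0 < t → ∀ ⦃f : E → F⦄ ⦃C : ℝ⦄,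
      AEStronglyMeasurable f volume → (∀ z, ‖f z‖ ≤ C) → ∀ x,
        ‖iteratedFDeriv ℝ k (heatExtension f t) x‖ ≤ A * t ^ (-(k : ℝ) / 2) * C := by
  induction k using Nat.strong_induction_on with
  | _ k ih =>
    cases k with
    | zero =>
      refine ⟨1, zero_le_one, fun t ht f C hf hC x => ?_⟩
      rw [norm_iteratedFDeriv_zero]
      simpa using norm_heatExtension_le_of_bound hC ht x
    | succ k =>
      -- constants for all orders `j ≤ k`
      choose A hA0 hA using fun j (hj : j < k + 1) => ih j hj
      set A' : ℕ → ℝ := fun j => if hj : j < k + 1 then A j hj else 0 with hA'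
      refine ⟨(2 : ℝ) ^ ((Module.finrank ℝ E : ℝ) / 2) * (2 : ℝ) ^ (((k : ℝ) + 1) / 2) *
        A' k, by
          have : 0 ≤ A' k := by simp only [hA', dif_pos (Nat.lt_succ_self k)]; exact hA0 _ _
          positivity, fun t ht f C hf hC x => ?_⟩
      have ht2 : 0 < t / 2 := by positivity
      have hC0 : 0 ≤ C := (norm_nonneg _).trans (hC x)
      have hmem : MemLp f ∞ (volume : Measure E) :=
        memLp_top_of_bound hf C (Eventually.of_forall hC)
      -- `e^{tΔ} f = e^{(t/2)Δ} g`, `g = e^{(t/2)Δ} f`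
      set g : E → F := heatExtension f (t / 2) with hg
      have hsemi : heatExtension f t = heatExtension g (t / 2) := by
        rw [hg, heatExtension_add_holds hmem le_top ht2 ht2, add_halves]
      have hgs : ContDiff ℝ k g :=
        (contDiff_heatExtension_holds hmem le_top ht2).of_le (by exact_mod_cast le_top)
      -- bounds on the derivatives of `g` of orders `≤ k`
      have hgb : ∀ j ≤ k, ∀ z, ‖iteratedFDeriv ℝ j g z‖ ≤ A' j * (t / 2) ^ (-(j : ℝ) / 2) * C := by
        intro j hj z
        have hj' : j < k + 1 := Nat.lt_succ_of_le hj
        simp only [hA', dif_pos hj']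
        exact hA j hj' ht2 hf hC z
      have hmain := norm_iteratedFDeriv_succ_heatExtension_le_of_bounded hgs hgb ht2 x
      rw [hsemi]
      refine hmain.trans (le_of_eq ?_)
      -- bookkeeping of the powers of `t / 2`
      have hsplit : ∀ e : ℝ, (t / 2) ^ e = t ^ e * 2 ^ (-e) := fun e => by
        rw [Real.div_rpow ht.le zero_le_two, Real.rpow_neg zero_le_two, div_eq_mul_inv]
      have h2 : (2 : ℝ) ^ (((k : ℝ) + 1) / 2) = 2 ^ (-(-(1 / 2 : ℝ))) * 2 ^ (-(-(k : ℝ) / 2)) := by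
        rw [← Real.rpow_add two_pos]; congr 1; ring
      have htt : t ^ (-((k + 1 : ℕ) : ℝ) / 2) = t ^ (-(1 / 2 : ℝ)) * t ^ (-(k : ℝ) / 2) := by
        rw [← Real.rpow_add ht]; congr 1; push_cast; ring
      rw [hsplit (-(1 / 2 : ℝ)), hsplit (-(k : ℝ) / 2), h2, htt]
      ring

end Literature.Analysis.UnboundedOperators

end
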